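import Literature.AnabelianGeometry.SemiGraphs.Corollary27iHoldsViaDecompositionGroups
import Literature.AnabelianGeometry.SemiGraphs.CuspOmissionSurfaceType
import Literature.IUT.HodgeTheaters.TemperedCoveringsHatHOfCor27

/-!
# [SemiAnbd] Cor. 2.7 (i) — the by-name consumers, now unconditional

Mochizuki, *Semi-graphs of anabelioids*, Publ. RIMS **42** (2006), Cor. 2.7 (i) p. 30
[cite: MochizukiSemiAnbd2006, Cor. 2.7(i) p.30]; *Inter-universal Teichmüller theory I* (kurims May 2020), §2
p. 44 l. 24–31 and Prop. 2.2 proof p. 46 l. 9–11 («by the evident pro-Σ̂ analogue of [SemiAnbd], Corollary 2.7, (i)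
… C_{Π̂_𝔾}(Π̂_ℍ) = Π̂_ℍ») [claim: Mochizuki2012, status: disputed] (nothing of the series is asserted).

abc-iut cell, layer L3 → L5 (abc-iut-w4-d071).  PROOF-ONLY file (no `def`, no new named fact).  With the named fact
`corollary_2_7_i` (FACT-LIST F-1458) a kernel THEOREM (`corollary_2_7_i_holds`,
`Corollary27iHoldsViaDecompositionGroups.lean`), every tree statement that took it as the hypothesis
`(h27 : corollary_2_7_i)` is discharged by name:

* abc-iut-L3-t1's cusp-omission forms (`CuspOmissionSubgraph.lean`, `CuspOmissionSurfaceType.lean`): `Π_K ⊆ Π_𝒢` and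
  `Π_v ⊆ Π_𝒢` are commensurably terminal for connected semi-graphs of anabelioids WITH cusps whose cusp-omitted graph is
  quasi-coherent with elevated vertices, in particular for semi-graphs of anabelioids of surface type;
* abc-iut-w5-d028's [IUTchI] Prop. 2.2 input `hHatH` (`TemperedCoveringsHatHOfCor27.lean`, GAP-LEDGER G-w5d028-1
  disposition (i)): `C_{Π̂_𝔾}(Π̂_ℍ) = Π̂_ℍ` from the agreement datum and the p. 44 atoms alone.

Honest framing: nothing here bears on [IUTchIII] Cor. 3.12; the [IUTchI] item is a by-name bridge, not an assertion of the
disputed series.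
-/

namespace Literature.AnabelianGeometry.SemiGraphs

namespace SemiGraphOfAnabelioids

open CategoryTheory CategoryTheory.PreGaloisCategory

universe v₁ u₁ u

variable {𝒢 : SemiGraphOfAnabelioids.{v₁, u₁, u}}

/-- **[SemiAnbd] Cor. 2.7 (i), sub-semi-graph clause, WITH cusps — unconditional**: for `𝒢` connected, `K ⊆ 𝔾`
connected with a vertex `w`, the cusp-omitted graph `𝒢_{𝔾_max}` quasi-coherent with the vertices of `K` elevated,
`Π_K ⊆ Π_𝒢` is commensurably terminal (abc-iut-L3-t1's reduction, fed with `corollary_2_7_i_holds`).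
[cite: MochizukiSemiAnbd2006, Cor. 2.7(i) p.30] -/
theorem isCommensurablyTerminal_range_piHToPi_cuspOmission (h𝒢 : 𝒢.IsConnected)
    (hq : (𝒢.restrict 𝒢.graph.maximalSubgraph).IsQuasiCoherent)
    (K : 𝒢.graph.Subgraph) (hK : K.toSemiGraph.IsConnected) (w : K.toSemiGraph.Vertex)
    (hel : ∀ v : K.toSemiGraph.Vertex,
      (𝒢.restrict 𝒢.graph.maximalSubgraph).IsElevated ⟨v.1, trivial⟩)
    (F : 𝒢.V w.1 ⥤ FintypeCat.{v₁}) [FiberFunctor F] :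
    AbsoluteAnabelian.IsCommensurablyTerminal (𝒢.piHToPi K w F).range :=
  isCommensurablyTerminal_range_piHToPi_of_corollary_2_7_i corollary_2_7_i_holds h𝒢 hq K hK w hel F

/-- **[SemiAnbd] Cor. 2.7 (i), vertex clause, WITH cusps — unconditional.**
[cite: MochizukiSemiAnbd2006, Cor. 2.7(i) p.30] -/
theorem isCommensurablyTerminal_range_piVToPi_cuspOmission (h𝒢 : 𝒢.IsConnected)
    (hq : (𝒢.restrict 𝒢.graph.maximalSubgraph).IsQuasiCoherent) (v : 𝒢.graph.Vertex)
    (hel : (𝒢.restrict 𝒢.graph.maximalSubgraph).IsElevated ⟨v, trivial⟩)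
    (F : 𝒢.V v ⥤ FintypeCat.{v₁}) [FiberFunctor F] :
    AbsoluteAnabelian.IsCommensurablyTerminal (𝒢.piVToPi v F).range :=
  isCommensurablyTerminal_range_piVToPi_of_corollary_2_7_i corollary_2_7_i_holds h𝒢 hq v hel F

/-- **[SemiAnbd] Cor. 2.7 (i), sub-semi-graph clause, for semi-graphs of anabelioids OF SURFACE TYPE (possibly with
cusps) — unconditional.** [cite: MochizukiSemiAnbd2006, Cor. 2.7(i) p.30] -/
theorem isCommensurablyTerminal_range_piHToPi_of_isOfSurfaceType' {Sigma : Set ℕ}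
    (hS : 𝒢.IsOfSurfaceType Sigma) (h𝒢 : 𝒢.IsConnected)
    (K : 𝒢.graph.Subgraph) (hK : K.toSemiGraph.IsConnected) (w : K.toSemiGraph.Vertex)
    (F : 𝒢.V w.1 ⥤ FintypeCat.{v₁}) [FiberFunctor F] :
    AbsoluteAnabelian.IsCommensurablyTerminal (𝒢.piHToPi K w F).range :=
  isCommensurablyTerminal_range_piHToPi_of_isOfSurfaceType corollary_2_7_i_holds hS h𝒢 K hK w F

/-- **[SemiAnbd] Cor. 2.7 (i), vertex clause, for semi-graphs of anabelioids OF SURFACE TYPE — unconditional.**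
[cite: MochizukiSemiAnbd2006, Cor. 2.7(i) p.30] -/
theorem isCommensurablyTerminal_range_piVToPi_of_isOfSurfaceType' {Sigma : Set ℕ}
    (hS : 𝒢.IsOfSurfaceType Sigma) (h𝒢 : 𝒢.IsConnected)
    (v : 𝒢.graph.Vertex) (F : 𝒢.V v ⥤ FintypeCat.{v₁}) [FiberFunctor F] :
    AbsoluteAnabelian.IsCommensurablyTerminal (𝒢.piVToPi v F).range :=
  isCommensurablyTerminal_range_piVToPi_of_isOfSurfaceType corollary_2_7_i_holds hS h𝒢 v F

end SemiGraphOfAnabelioids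

end Literature.AnabelianGeometry.SemiGraphs

namespace Literature.IUT.HodgeTheaters

open CategoryTheory CategoryTheory.PreGaloisCategory
open Literature.AnabelianGeometry.SemiGraphs (SemiGraphOfAnabelioids)
open Literature.AnabelianGeometry.AbsoluteAnabelian (IsCommensurablyTerminal)

universe v₁ u₁ u' u

namespace TemperedGraphGroupData

variable (D : TemperedGraphGroupData.{u})

/-- **[IUTchI] Prop. 2.2's cited input `hHatH` — `C_{Π̂_𝔾}(Π̂_ℍ) = Π̂_ℍ` — from the agreement datum and the p. 44 atoms
ALONE** (abc-iut-w5-d028's `hatH_commTerminal_of_corollary_2_7_i` with F-1458 discharged by `corollary_2_7_i_holds`):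
GAP-LEDGER G-w5d028-1 disposition (i), now unconditional in [SemiAnbd] Cor. 2.7 (i).
([IUTchI] Prop 2.2 p.46) [claim: Mochizuki2012, status: disputed] -/
theorem hatH_commTerminal {𝒢 : SemiGraphOfAnabelioids.{v₁, u₁, u'}} (h𝒢 : 𝒢.IsConnected)
    (hq : (𝒢.restrict 𝒢.graph.maximalSubgraph).IsQuasiCoherent)
    (K : 𝒢.graph.Subgraph) (hK : K.toSemiGraph.IsConnected) (w : K.toSemiGraph.Vertex)
    (hel : ∀ v : K.toSemiGraph.Vertex, (𝒢.restrict 𝒢.graph.maximalSubgraph).IsElevated ⟨v.1, trivial⟩)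
    (F : 𝒢.V w.1 ⥤ FintypeCat.{v₁}) [FiberFunctor F]
    (eHat : D.Hat ≃* 𝒢.Pi w.1 F) (hrange : D.HatH.map eHat.toMonoidHom = (𝒢.piHToPi K w F).range) :
    IsCommensurablyTerminal D.HatH :=
  D.hatH_commTerminal_of_corollary_2_7_i SemiGraphOfAnabelioids.corollary_2_7_i_holds h𝒢 hq K hK w hel F eHat
    hrange

end TemperedGraphGroupData

end Literature.IUT.HodgeTheaters
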